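import Summits.QuantumFields.YangMills.Theorems.WeakCouplingRatesColdBoxCovBookkeeping

/-!
# Crux `BulkDominatesColdBoxW` (stmt-QuantumFields-19609), stub `stub_kernelMeanExpansion`: MEAN BOOKKEEPING — from the tilted conditioned reference
# to the reference, for an observable close to a square-integrable surrogate on the good event

The mean twin of `abs_cov_tilted_cond_sub_cov_le` (`Theorems/WeakCouplingRatesColdBoxCovBookkeeping.lean`, seat `ym-wcr-19456-p1`; the sibling crux
`ColdBoxTwoPointFloorW` only needs covariances, the 19609 interface `KernelMeanExpansion` needs means).  Abstract probability (no lattice objects):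
`γ` a probability measure, `S` a measurable event with `γ(Sᶜ) ≤ p`, `γ(S) ≠ 0`, `W` a measurable tilt with `|𝟙_S W| ≤ w`, `ν := (γ[|S]).tilted (𝟙_S W)`;
an observable `F` with `0 ≤ F ≤ M` on `S` and a surrogate `Q ∈ L²(γ)` with `|F − Q| ≤ τ` on `S`, `∫Q² ≤ K²`.  Then

  **`abs_integral_tilted_cond_sub_integral_le`**: `|E_ν[F] − E_γ[Q]| ≤ M(e^{2w} − 1) + 2Mp + τ + √p·K`.

Steps: `ν` lives on `S` (replace `F` by `𝟙_S F`); the tilt costs `M(e^{2w} − 1)` (`abs_integral_tilted_sub_le`); the conditioning costs `2Mp`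
(`abs_integral_sub_integral_cond_le`); under `γ`, `|𝟙_S F − Q| ≤ τ + 𝟙_{Sᶜ}|Q|` and `∫𝟙_{Sᶜ}|Q| ≤ √p·√(∫Q²)` (`integral_indicator_mul_abs_le_sqrt`).
In the one-scale expansion: `γ = boxDirichlet^{⊗3}` (shifted), `S` = small fields, `F = β·cost_q ∘ chart`, `Q = ½Σ_c (F̄_c + X_c)²`, whose `γ`-mean is
`(3/2)V_D + ½ΣF̄_c²` (`integral_quadObs_pi_eq`) and `∫Q² ≤ 6Σ_c(F̄_c⁴ + 3V_D²)` (`integral_quadObs_sq_pi_le`).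

Fleet seat `ym-spine-20043-p1` (g3; Gaussian/bookkeeping side of the work split with `ym-wcr-19609-p1`).  No sorry, standard axioms, no new definition,
no named-fact hypothesis.  NOT a claim about the mass gap.
-/

set_option autoImplicit false

noncomputable section

open MeasureTheory ProbabilityTheory Real

namespace Summit.QuantumFields.YangMills.Theorems.WeakCouplingRates

variable {Ω : Type*} [MeasurableSpace Ω] {γ : Measure Ω} [IsProbabilityMeasure γ]

/-- **Surrogate replacement under `γ` (means).**  If `|F' − Q| ≤ τ + 𝟙_{Sᶜ}|Q|` pointwise, `γ(Sᶜ) ≤ p`, `∫Q² ≤ K²` (`K ≥ 0`), and `F'` is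
integrable, then `|E_γ[F'] − E_γ[Q]| ≤ τ + √p·K`. -/
theorem abs_integral_sub_integral_surrogate_le {S : Set Ω} (hS : MeasurableSet S) {F' Q : Ω → ℝ}
    (hF'i : Integrable F' γ) (hQ : MemLp Q 2 γ) {τ K p : ℝ} (hK : 0 ≤ K)
    (hFQ : ∀ ω, |F' ω - Q ω| ≤ τ + Sᶜ.indicator (fun ω => |Q ω|) ω)
    (hp : γ.real Sᶜ ≤ p) (hKQ : ∫ ω, Q ω ^ 2 ∂γ ≤ K ^ 2) :
    |(∫ ω, F' ω ∂γ) - ∫ ω, Q ω ∂γ| ≤ τ + Real.sqrt p * K := by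
  have hQi : Integrable Q γ := hQ.integrable one_le_two
  have hind : Integrable (fun ω => Sᶜ.indicator (fun _ => (1 : ℝ)) ω * |Q ω|) γ := by
    refine hQi.abs.bdd_mul (c := 1) ((measurable_const.indicator hS.compl).aestronglyMeasurable) (ae_of_all _ fun ω => ?_)
    by_cases hω : ω ∈ Sᶜ <;> simp [hω]
  have hind' : ∀ ω, Sᶜ.indicator (fun ω => |Q ω|) ω = Sᶜ.indicator (fun _ => (1 : ℝ)) ω * |Q ω| := fun ω => by
    by_cases hω : ω ∈ Sᶜ <;> simp [hω]
  have hp0 : 0 ≤ p := le_trans measureReal_nonneg hp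
  rw [← integral_sub hF'i hQi]
  calc |∫ ω, F' ω - Q ω ∂γ| ≤ ∫ ω, |F' ω - Q ω| ∂γ := abs_integral_le_integral_abs
    _ ≤ ∫ ω, τ + Sᶜ.indicator (fun _ => (1 : ℝ)) ω * |Q ω| ∂γ := by
        refine integral_mono_of_nonneg (ae_of_all _ fun ω => abs_nonneg _) ((integrable_const τ).add hind)
          (ae_of_all _ fun ω => ?_)
        dsimp only
        rw [← hind' ω]; exact hFQ ω
    _ = τ + ∫ ω, Sᶜ.indicator (fun _ => (1 : ℝ)) ω * |Q ω| ∂γ := by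
        rw [integral_add (integrable_const τ) hind, integral_const, smul_eq_mul, probReal_univ, one_mul]
    _ ≤ τ + Real.sqrt (γ.real Sᶜ) * Real.sqrt (∫ ω, Q ω ^ 2 ∂γ) := by
        gcongr; exact integral_indicator_mul_abs_le_sqrt hS.compl hQ
    _ ≤ τ + Real.sqrt p * K := by
        have h1 : Real.sqrt (γ.real Sᶜ) ≤ Real.sqrt p := Real.sqrt_le_sqrt hp
        have h2 : Real.sqrt (∫ ω, Q ω ^ 2 ∂γ) ≤ K :=
          calc Real.sqrt (∫ ω, Q ω ^ 2 ∂γ) ≤ Real.sqrt (K ^ 2) := Real.sqrt_le_sqrt hKQ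
            _ = K := Real.sqrt_sq hK
        have h3 := mul_le_mul h1 h2 (Real.sqrt_nonneg _) (Real.sqrt_nonneg _)
        linarith

/-- **Mean bookkeeping.**  With `ν = (γ[|S]).tilted (𝟙_S W)`, `|𝟙_S W| ≤ w`, `0 ≤ F ≤ M` on `S`, `|F − Q| ≤ τ` on `S`, `γ(Sᶜ) ≤ p`, `γ(S) ≠ 0`,
`Q ∈ L²(γ)` with `∫Q² ≤ K²`:  `|E_ν[F] − E_γ[Q]| ≤ M(e^{2w} − 1) + 2Mp + τ + √p·K`. -/
theorem abs_integral_tilted_cond_sub_integral_le {S : Set Ω} (hS : MeasurableSet S) (hS0 : γ S ≠ 0) {W : Ω → ℝ} (hWm : Measurable W)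
    {w : ℝ} (hW : ∀ ω, |S.indicator W ω| ≤ w) {F Q : Ω → ℝ} (hFm : Measurable F) (hQ : MemLp Q 2 γ)
    {M τ K p : ℝ} (hM : 0 ≤ M) (hK : 0 ≤ K)
    (hF : ∀ ω ∈ S, 0 ≤ F ω ∧ F ω ≤ M) (hFQ : ∀ ω ∈ S, |F ω - Q ω| ≤ τ)
    (hp : γ.real Sᶜ ≤ p) (hKQ : ∫ ω, Q ω ^ 2 ∂γ ≤ K ^ 2) :
    |(∫ ω, F ω ∂((γ[|S]).tilted (S.indicator W))) - ∫ ω, Q ω ∂γ| ≤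
      M * (exp (2 * w) - 1) + 2 * M * p + τ + Real.sqrt p * K := by
  haveI : IsProbabilityMeasure (γ[|S]) := cond_isProbabilityMeasure hS0
  set μS := γ[|S] with hμS
  set ν := μS.tilted (S.indicator W) with hν
  set F' := S.indicator F with hF'
  have hF'm : Measurable F' := hFm.indicator hS
  have hF'b : ∀ ω, |F' ω| ≤ M := fun ω => by
    by_cases hω : ω ∈ S
    · rw [hF', Set.indicator_of_mem hω, abs_of_nonneg (hF ω hω).1]; exact (hF ω hω).2
    · rw [hF', Set.indicator_of_notMem hω, abs_zero]; exact hM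
  -- (i) `ν` lives on `S`: replace `F` by `F'`
  have hμSc : μS Sᶜ = 0 := cond_compl_eq_zero S hS
  have hνc : ν Sᶜ = 0 := (tilted_absolutelyContinuous μS _) hμSc
  have haeF : (fun ω => F ω) =ᵐ[ν] F' := by
    refine (ae_iff.2 ?_)
    refine measure_mono_null (fun ω hω => ?_) hνc
    intro hωS; exact hω (by rw [hF', Set.indicator_of_mem hωS])
  rw [integral_congr_ae haeF]
  -- (ii) the tilt
  have hF'iS : Integrable F' μS := integrable_of_abs_le hF'm.aestronglyMeasurable hF'b
  have htilt := abs_integral_tilted_sub_le (ν := μS) (hWm.indicator hS) hW hF'iS hF'b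
  -- (iii) the conditioning
  have hF'i : Integrable F' γ := integrable_of_abs_le hF'm.aestronglyMeasurable hF'b
  have hcond := abs_integral_sub_integral_cond_le (μ := γ) hS hS0 hF'i hF'b
  -- (iv) the surrogate under `γ`
  have hFQ' : ∀ ω, |F' ω - Q ω| ≤ τ + Sᶜ.indicator (fun ω => |Q ω|) ω := fun ω => by
    by_cases hω : ω ∈ S
    · rw [hF', Set.indicator_of_mem hω, Set.indicator_of_notMem (Set.notMem_compl_iff.2 hω), add_zero]; exact hFQ ω hω
    · rw [hF', Set.indicator_of_notMem hω, Set.indicator_of_mem (Set.mem_compl hω), zero_sub, abs_neg]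
      have hτ0 : 0 ≤ τ := by
        obtain ⟨ω₀, hω₀⟩ : S.Nonempty := by
          by_contra h
          rw [Set.not_nonempty_iff_eq_empty] at h
          exact hS0 (by rw [h, measure_empty])
        exact (abs_nonneg _).trans (hFQ ω₀ hω₀)
      linarith
  have hsur := abs_integral_sub_integral_surrogate_le (γ := γ) hS hF'i hQ hK hFQ' hp hKQ
  -- assemble
  have hpM : 2 * M * γ.real Sᶜ ≤ 2 * M * p := by nlinarith [measureReal_nonneg (μ := γ) (s := Sᶜ)]
  calc |(∫ ω, F' ω ∂ν) - ∫ ω, Q ω ∂γ|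
      ≤ |(∫ ω, F' ω ∂ν) - ∫ ω, F' ω ∂μS| + |(∫ ω, F' ω ∂μS) - ∫ ω, F' ω ∂γ| + |(∫ ω, F' ω ∂γ) - ∫ ω, Q ω ∂γ| :=
        (abs_sub_le _ (∫ ω, F' ω ∂γ) _).trans (add_le_add (abs_sub_le _ _ _) le_rfl)
    _ ≤ M * (exp (2 * w) - 1) + 2 * M * γ.real Sᶜ + (τ + Real.sqrt p * K) := by
        refine add_le_add (add_le_add htilt ?_) hsur
        rw [abs_sub_comm]; exact hcond
    _ ≤ _ := by linarith

end Summit.QuantumFields.YangMills.Theorems.WeakCouplingRates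

end
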